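import Summits.QuantumFields.YangMills.Theorems.FluctuationComparisonRegPrIntLRunPairOrganRungOfRows
import Summits.QuantumFields.YangMills.Theorems.FluctuationComparisonRegPrIntLRunPairOrganSeedOfTables
import HarnessLib

/-!
# R3 PATH B (run-pair organ) — FILE P-B3: THE RUNG LEAF FROM THE FIVE REGISTERED ORGAN INPUTS {S1a, 26243, S2α′, S2β, O1}, IN `Theorems/` (★★OWNER WORDS 91∕93, RECORD 17bm)

Width seat `ym-ust-19936-w3` (gen 20).  Ten-line composition of P-B2 (this seat, `…RunPairOrganRungOfRows`: leaf ⟸ {S1a, 26243, S2 seed, O1}) with P-B1 (px21 g12,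
`…RunPairOrganSeedOfTables`: S2α′ ∧ S2β ⟹ S2 — the organ's S2-stage glue ported verbatim): the OWNER's PATH-B letter
`ym3TorusSU2_of_runPairOrganRows (hS1a) (h26243) (hS2α′) (hS2β) (hO1) : …T3YM3TorusStatement.YM3TorusSU2`, binders = the run-pair organ workfile
`Cruxes/FluctuationComparisonRegPrIntL/Lines/runpair_organ.lean` v15's texts VERBATIM (S1a :111–:127, S2α′ :202–:216, S2β :235–:255) + the crux `FirstExitWindowTailL`
(stmt-QuantumFields-26243) BY NAME + O1 by its landed `Theorems/` copy `RunPairOrgan.OneStepContractionRun`.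
HONEST: a composition; proves NONE of the five inputs; the R3 leaf is NOT proved — REDUCED BY NAME to {S1a, 26243, S2α′, S2β, O1} along PATH B (beside PATH A's ✓p758552
{EX, 20520 decl, (O‴χₛ)}); rung R3 = SU(2) YM₃ on T³ — NOT d = 4, NOT infinite volume, NOT a mass gap, NOT Clay.
-/

set_option autoImplicit false

noncomputable section

namespace Summit.QuantumFields.YangMills.Theorems.FluctuationComparisonRegPrIntL.RunPairOrganRung

open MeasureTheory Filter Topology
open Literature.MathematicalPhysics.QuantumFieldTheory.Balaban1983to89 T3ContinuumYM3Torus T3NestedUnitLaws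
  T3UnitLawDensityEML T4Continuum BalabanUVClass T3UnitScaleTilt T3PrintedRegularMinimiser
open Summit.QuantumFields.YangMills.Theorems.FluctuationComparisonRegPrIntL.RunPairOrgan

/-- ★★★ **R3 PATH B AS A `Theorems/` THEOREM OVER THE FIVE REGISTERED ORGAN INPUTS**: the rung leaf from S1a `RunClassMembership` (text VERBATIM), the crux
`FirstExitWindow.FirstExitWindowTailL` (26243, BY NAME), S2α′ `ClassicalPerHeight` (text VERBATIM), S2β `FluctuationPartSmall` (text v15 VERBATIM) and O1
(`RunPairOrgan.OneStepContractionRun`) — `ym3TorusSU2_of_runPairOrganRowsSeed hS1a h26243 (runPairSeed_of_tables hS2α' hS2β) hO1`.  CONDITIONAL on five OPEN rows; proves none.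
[cite: Balaban1985UV3, (5) p.256, (7) p.257, (41) p.266, (45)–(47) p.267, (71) p.273; Balaban1985Variational, Thm 1 p.279; Balaban1987RG1, (0.11) p.253] -/
theorem ym3TorusSU2_of_runPairOrganRows
    (hS1a : ∀ (L : ℕ), ∃ pm : ℝ, 0 < pm ∧ ∀ (p₀ : ℝ), pm ≤ p₀ → ∃ b₀ : ℝ, 0 < b₀ ∧ ∃ γ₁ : ℝ, 0 < γ₁ ∧ ∀ (F : T3Family) (γ : ℝ), F.L = L → 0 < γ → γ ≤ γ₁ →
      ∃ (j₀ : ℕ) (prm : ℕ → ClassParams), AdmissibleClassParams F γ b₀ p₀ prm ∧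
      ∀ (ν : ℕ → (j : ℕ) → Measure (GaugeField (F.P j) 0 (Matrix.specialUnitaryGroup (Fin 2) ℂ))),
      (∀ K, ν K K = T4GenFunBounds.gibbsMeasure (F.P K) ((F.scheme ℰp γ).β K)) →
      (∀ K j, j < K → ν K j = Measure.map (descend F ℰp j) (ν K (j + 1))) →
      ∃ ρ : ℕ → (j : ℕ) → GaugeField (F.P j) 0 (Matrix.specialUnitaryGroup (Fin 2) ℂ) → ℝ,
      ∀ (K j : ℕ) (hjK : j ≤ K), j₀ ≤ j →
      (∀ U, PlaqSmall (θBal F.L γ b₀ p₀ j) U → 0 < ρ K j U) ∧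
      ν K j = (fieldMeasure _ _ _).withDensity (fun U => ENNReal.ofReal (ρ K j U)) ∧
      MemOfRun F ℰp hjK (prm j) (ρ K j) ∧
      ContinuousOn (ρ K j) {U | PlaqSmall (θBal F.L γ b₀ p₀ j) U})
    (h26243 : Summit.QuantumFields.YangMills.Theses.FirstExitWindow.FirstExitWindowTailL)
    (hS2α' : ∀ (L : ℕ) (b₀ p₀ : ℝ), 0 < b₀ → 0 < p₀ → ∃ ε₁ : ℝ, 0 < ε₁ ∧ ∀ (ε₀ : ℝ), 0 < ε₀ → ε₀ ≤ ε₁ →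
      ∃ γ₁ : ℝ, 0 < γ₁ ∧ ∀ (F : T3Family) (γ : ℝ), F.L = L → 0 < γ → γ ≤ γ₁ →
      ∀ J : ℕ, ∃ A : ℕ → ℝ, (∀ n, 0 ≤ A n) ∧ Tendsto A atTop (𝓝 0) ∧
      ∀ (K K' : ℕ) (hJK : J ≤ K) (hJK' : J ≤ K'), K ≤ K' →
      ∀ (b b' : PBond (F.P J) 0) (U V W Z : GaugeField (F.P J) 0 (Matrix.specialUnitaryGroup (Fin 2) ℂ)),
      PlaqSmall (θBal F.L γ b₀ p₀ J) U → PlaqSmall (θBal F.L γ b₀ p₀ J) V →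
      PlaqSmall (θBal F.L γ b₀ p₀ J) W → PlaqSmall (θBal F.L γ b₀ p₀ J) Z →
      (∀ e, e ≠ b → U e = V e) → (∀ e, e ≠ b' → U e = W e) → (∀ e, e ≠ b' → V e = Z e) → (∀ e, e ≠ b → W e = Z e) →
      |((F.scheme ℰp γ).β K * minActionRegPr F J K hJK ε₀ U - (F.scheme ℰp γ).β K' * minActionRegPr F J K' hJK' ε₀ U)
      - ((F.scheme ℰp γ).β K * minActionRegPr F J K hJK ε₀ V - (F.scheme ℰp γ).β K' * minActionRegPr F J K' hJK' ε₀ V)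
      - (((F.scheme ℰp γ).β K * minActionRegPr F J K hJK ε₀ W - (F.scheme ℰp γ).β K' * minActionRegPr F J K' hJK' ε₀ W)
      - ((F.scheme ℰp γ).β K * minActionRegPr F J K hJK ε₀ Z - (F.scheme ℰp γ).β K' * minActionRegPr F J K' hJK' ε₀ Z))|
      ≤ A (K - J))
    (hS2β : ∀ (L : ℕ), ∃ pS : ℝ, ∀ (b₀ p₀ : ℝ), 0 < b₀ → pS ≤ p₀ → 0 < p₀ → ∃ ε₁ : ℝ, 0 < ε₁ ∧ ∀ (ε₀ : ℝ), 0 < ε₀ → ε₀ ≤ ε₁ →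
      ∃ γ₁ : ℝ, 0 < γ₁ ∧ ∃ κ : ℝ, 0 < κ ∧ ∀ (F : T3Family) (γ : ℝ), F.L = L → 0 < γ → γ ≤ γ₁ →
      ∃ (φ : ℕ → ℝ), (∀ J, 0 ≤ φ J) ∧ Tendsto (fun J : ℕ => (J : ℝ) * φ J) atTop (𝓝 0) ∧
      ∀ (ν : ℕ → (j : ℕ) → Measure (GaugeField (F.P j) 0 (Matrix.specialUnitaryGroup (Fin 2) ℂ))),
      (∀ K, ν K K = T4GenFunBounds.gibbsMeasure (F.P K) ((F.scheme ℰp γ).β K)) →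
      (∀ K j, j < K → ν K j = Measure.map (descend F ℰp j) (ν K (j + 1))) →
      ∀ (J K : ℕ) (hJK : J ≤ K) (ρ : GaugeField (F.P J) 0 (Matrix.specialUnitaryGroup (Fin 2) ℂ) → ℝ),
      (∀ U, PlaqSmall (θBal F.L γ b₀ p₀ J) U → 0 < ρ U) →
      ν K J = (fieldMeasure _ _ _).withDensity (fun U => ENNReal.ofReal (ρ U)) →
      ContinuousOn ρ {U | PlaqSmall (θBal F.L γ b₀ p₀ J) U} →
      ∀ (b b' : PBond (F.P J) 0) (U V W Z : GaugeField (F.P J) 0 (Matrix.specialUnitaryGroup (Fin 2) ℂ)),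
      PlaqSmall (θBal F.L γ b₀ p₀ J) U → PlaqSmall (θBal F.L γ b₀ p₀ J) V →
      PlaqSmall (θBal F.L γ b₀ p₀ J) W → PlaqSmall (θBal F.L γ b₀ p₀ J) Z →
      (∀ e, e ≠ b → U e = V e) → (∀ e, e ≠ b' → U e = W e) → (∀ e, e ≠ b' → V e = Z e) → (∀ e, e ≠ b → W e = Z e) →
      |((Real.log (ρ U) + (F.scheme ℰp γ).β K * minActionRegPr F J K hJK ε₀ U)
      - (Real.log (ρ V) + (F.scheme ℰp γ).β K * minActionRegPr F J K hJK ε₀ V))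
      - ((Real.log (ρ W) + (F.scheme ℰp γ).β K * minActionRegPr F J K hJK ε₀ W)
      - (Real.log (ρ Z) + (F.scheme ℰp γ).β K * minActionRegPr F J K hJK ε₀ Z))|
      ≤ φ J * Real.exp (-(κ * (b.src.tdist b'.src : ℝ))))
    (hO1 : OneStepContractionRun) :
    Literature.MathematicalPhysics.QuantumFieldTheory.Balaban1983to89.T3YM3TorusStatement.YM3TorusSU2 :=
  ym3TorusSU2_of_runPairOrganRowsSeed hS1a h26243 (runPairSeed_of_tables hS2α' hS2β) hO1

end Summit.QuantumFields.YangMills.Theorems.FluctuationComparisonRegPrIntL.RunPairOrganRung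

end
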